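import Summits.BirchSwinnertonDyer.BirchSwinnertonDyer.Theorems.GenusKolyvaginAtTwoK4NegOrdinaryWitnessNonPhantom
import Summits.BirchSwinnertonDyer.BirchSwinnertonDyer.Theorems.GenusKolyvaginAtTwoK4NegTwinBsdRoadNonPhantomTwoAdicIff
import Literature.NumberTheory.EllipticCurves.BSDSelmerPConverseSerreProofs
import Literature.NumberTheory.EllipticCurves.CyclotomicZpExtensionLayerTorsionProofs
import Literature.NumberTheory.GaloisRepresentations.LocalKroneckerWeberInertiaProofs
import HarnessLib

/-!
# Route `GenusKolyvaginAtTwo`, K₄⁻ kernel `K4Neg` (stmt-BirchSwinnertonDyer-31526), LINE 34 «twin_bsd_road⁻» v1.5 (F4ᵖᵍ census):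
# THE ORDINARY WITNESS, DISCHARGED — at a place of good ORDINARY reduction above `2` where `E[2]` is UNRAMIFIED, the Lawson–Wuthrich
# class is NEVER a Kummer class

Width seat `bsd-line-gk2-p5` g42 (cell `bsd-f1-sign2`), WIDTH-5 attach on route `GenusKolyvaginAtTwo` rev 59, lane `(NPh_K)` off
the cut.  `--supports stmt-BirchSwinnertonDyer-31526 --as helper`.  THEOREMS ONLY (no definition, no named fact, no `sorry`); standard
axioms.  **BSD is NOT proved by this file; `K4Neg` is NOT proved; no item is closed by it.**

WHAT.  `…K4NegOrdinaryWitnessAtTwo` (this seat) proved the ORDINARY WITNESS CRITERION: at `v ∋ 2` of good ordinary reduction, an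
inertia element `τ` fixing `E[2]` whose datum `A` on `E[4]` (`τP = P + A(2P)`) has `A ∘ A ≠ 0` makes the Lawson–Wuthrich class `ξ_E`
non-Kummer at `v`.  This file PRODUCES such a `τ` whenever `E[2]` is unramified at `v`:
* §1 (finite, `decide` over `2 × 2` matrices over `ℤ/4`) `sub_eq_one_of_frame_conditions` — a matrix `M ∈ M₂(ℤ/4)` fixing the
  `2`-torsion vectors and such that `M r = r` whenever `2r = (M − 1)e_i` has `det M = 1` (i.e. `M = 1 + 2N` with `N̄` nilpotent).
* §2 ★ `datum_comp_ne_zero_of_cyclotomicCharacter` — **for `σ ∈ Γ_{ℚ(E[2])}` with datum `A` and `2`-adic cyclotomic character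
  `χ(σ) = −1` (`σ ζ₄ = ζ₄⁻¹`), `A ∘ A ≠ 0`**: otherwise §1 applies to the matrix of `σ` on `E[4]` in any frame (`σR = R` whenever
  `2R = σP − P`, because `A(2R) = A(A(2P)) = 0`), so `det ρ_{E,4}(σ) = 1`; but `det ρ_{E,4} = χ₄` (the tree's `det_eq_modNCyclotomicCharacter`,
  Weil pairing) and `χ₄(σ) = −1`.
* §3 ★★★ `not_mem_selmerLocalKer_two_of_unramified_twoTorsion` — **`W/ℚ` elliptic, `ρ̄_{W,2}`, `ρ_{W,4}` onto, `v ∋ 2` of good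
  ORDINARY reduction, `E[2]` UNRAMIFIED at `v` (every inertia element fixes `E[2]`): then the non-zero class of `H¹(ℚ, E[2])` dying on
  `Γ_{ℚ(E[4])}` is NOT in `selmerLocalKer W ℚ_v 2`** — `χ₂(I_{ℚ_v}) = ℤ₂ˣ` (tree: `adicCompletion_rat_exists_mem_absInertia_cyclotomicCharacter_eq`)
  gives an inertial `τ` with `χ(τ) = −1`, §2 gives `A_τ ∘ A_τ ≠ 0`, and the criterion concludes; ★★★′
  `offCutNonPhantomAtTwo_of_unramified_twoTorsion` — the F4″-shaped `(NPh_K)` at every `2`-split admissible frame.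
READING (LINE 34 v1.5 census; nothing closed).  For good ordinary `E/ℚ₂`, `ℚ₂(E[2]) = ℚ₂(√Δ)`, so «`E[2]` unramified at `2`» is
«`Δ_min ≡ 1 (mod 4)`»: on those cells the NPh road is ALIVE by a theorem (third witness mechanism, after the Tate transvection and the
real place).  The translation «`Δ_min ≡ 1 (4)` ⟹ `E[2]` unramified» is left to the reader of the `2`-division field (not in this file).
BSD is NOT proved by any of this.

References: [SerreInventiones1972] §1.11; [SerreLocalFields1979] IV §4 Prop. 17; [SilvermanCSS1997] Ch. II §7–8 (`det ρ̄_m = χ_m`);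
[LawsonWuthrich2016] §3, §7.1.
-/

set_option linter.dupNamespace false -- `Summit.<P>.<Sub>` repeats `BirchSwinnertonDyer` (D-0017)
set_option autoImplicit false

/-! ## §1 The finite lemma over `ℤ/4` -/

namespace Summit.BirchSwinnertonDyer.BirchSwinnertonDyer.Theorems.GenusExact.Lw2PhantomExclusion.OrdinaryWitness

open Matrix

/-- For `M = (a b; c d) ∈ M₂(ℤ/4)` fixing the `2`-torsion vectors (i.e. `M ≡ 1 mod 2`), the «half» vector `r₁ = ((a−1)/2, c/2)`
satisfies `2 r₁ = (M − 1) e₁`. [folklore] -/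
theorem half_fst_add_self (a b c d : ZMod 4)
    (h1 : !![a, b; c, d] *ᵥ ![2, 0] = ![2, 0]) (h2 : !![a, b; c, d] *ᵥ ![0, 2] = ![0, 2]) :
    (![(((a - 1).val / 2 : ℕ) : ZMod 4), ((c.val / 2 : ℕ) : ZMod 4)] : Fin 2 → ZMod 4) +
        ![(((a - 1).val / 2 : ℕ) : ZMod 4), ((c.val / 2 : ℕ) : ZMod 4)] =
      !![a, b; c, d] *ᵥ ![1, 0] - ![1, 0] := by
  revert a b c d
  decide

/-- Companion of `half_fst_add_self` for the second basis vector. [folklore] -/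
theorem half_snd_add_self (a b c d : ZMod 4)
    (h1 : !![a, b; c, d] *ᵥ ![2, 0] = ![2, 0]) (h2 : !![a, b; c, d] *ᵥ ![0, 2] = ![0, 2]) :
    (![((b.val / 2 : ℕ) : ZMod 4), (((d - 1).val / 2 : ℕ) : ZMod 4)] : Fin 2 → ZMod 4) +
        ![((b.val / 2 : ℕ) : ZMod 4), (((d - 1).val / 2 : ℕ) : ZMod 4)] =
      !![a, b; c, d] *ᵥ ![0, 1] - ![0, 1] := by
  revert a b c d
  decide

/-- **A matrix `M ∈ M₂(ℤ/4)` fixing the `2`-torsion vectors `(2,0)`, `(0,2)` (so `M = 1 + 2N`) and fixing the two «half» vectors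
`r_i` with `2 r_i = (M − 1) e_i` has `det M = 1`** (the hypotheses say `N̄² = 0`, so `tr N̄ = 0` and `det M = 1 + 2 tr N = 1`).
A `decide` over the entries. [folklore] -/
theorem sub_eq_one_of_frame_conditions (a b c d : ZMod 4)
    (h1 : !![a, b; c, d] *ᵥ ![2, 0] = ![2, 0]) (h2 : !![a, b; c, d] *ᵥ ![0, 2] = ![0, 2])
    (h3 : !![a, b; c, d] *ᵥ ![(((a - 1).val / 2 : ℕ) : ZMod 4), ((c.val / 2 : ℕ) : ZMod 4)] =
      ![(((a - 1).val / 2 : ℕ) : ZMod 4), ((c.val / 2 : ℕ) : ZMod 4)])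
    (h4 : !![a, b; c, d] *ᵥ ![((b.val / 2 : ℕ) : ZMod 4), (((d - 1).val / 2 : ℕ) : ZMod 4)] =
      ![((b.val / 2 : ℕ) : ZMod 4), (((d - 1).val / 2 : ℕ) : ZMod 4)]) :
    a * d - b * c = 1 := by
  revert a b c d
  decide

end Summit.BirchSwinnertonDyer.BirchSwinnertonDyer.Theorems.GenusExact.Lw2PhantomExclusion.OrdinaryWitness


noncomputable section

open scoped NumberField

namespace Summit.BirchSwinnertonDyer.BirchSwinnertonDyer.Theorems.GenusExact.Lw2PhantomExclusion.OrdinaryWitness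

open WeierstrassCurve Field NumberField IsDedekindDomain
open Literature.NumberTheory.GaloisRepresentations Literature.NumberTheory.EllipticCurves
open Literature.NumberTheory Matrix
open Summit.BirchSwinnertonDyer.BirchSwinnertonDyer.Theorems.GenusKolyTwistingPrime
open Summit.BirchSwinnertonDyer.BirchSwinnertonDyer.Theorems.GenusExact.VisiblePairAtTwo (natCast_prime_mem_iff_eq)


/-! ## §2 ★ A datum with `χ₄ = −1` is not nilpotent -/

section Datum

variable (W : WeierstrassCurve ℚ) [W.IsElliptic]

/-- ★ **`χ₄(σ) = −1` forces `A_σ ∘ A_σ ≠ 0`.**  `W/ℚ` elliptic; `σ ∈ Γ_ℚ` acting on `E[4]` as `P ↦ P + A(2P)` (a datum: `σ` fixes `E[2]`)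
with `2`-adic cyclotomic character `χ(σ) = −1`.  Then `A ∘ A ≠ 0`.  Proof: in a frame of `E[4]` the matrix `M` of `σ` has
`det M = χ₄(σ) = −1` (`det_eq_modNCyclotomicCharacter`, Weil pairing; `modNCyclotomicCharacter_eq_toZModPow`); if `A ∘ A = 0` then `σ`
fixes every `R` with `2R = σP − P` (`A(2R) = A(A(2P)) = 0`), and §1 gives `det M = 1`. [cite: SilvermanCSS1997, Ch. II §7 Proposition and §8]
[cite: SerreAbelianLadic1968, Ch. I §1.2] -/
theorem datum_comp_ne_zero_of_cyclotomicCharacter {σ : absoluteGaloisGroup ℚ}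
    {A : geomTorsion W (2 : ℤ) →+ geomTorsion W (2 : ℤ)}
    (hA : ∀ P : geomTorsion W (4 : ℤ), ((σ • P : geomTorsion W (4 : ℤ)) : geomPoints W) =
      (P : geomPoints W) + (A ⟨(2 : ℤ) • (P : geomPoints W), two_zsmul_mem_geomTorsion_two W P⟩ : geomPoints W))
    (hχ : GaloisRep.cyclotomicCharacter ℚ 2 σ = -1) :
    A.comp A ≠ 0 := by
  intro hAA
  haveI : Fact (Nat.Prime 2) := ⟨Nat.prime_two⟩
  haveI : NeZero ((2 ^ 2 : ℕ) : ℚ) := ⟨by norm_num⟩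
  haveI : NeZero ((2 : ℕ) : ℚ) := ⟨by norm_num⟩
  have h4 : ((2 ^ 2 : ℕ) : ℤ) = 4 := by norm_num
  -- a frame of `E[4]` and the matrix of `σ`
  obtain ⟨e⟩ := nonempty_addEquiv_geomTorsion W 2 2 (by norm_num) (by norm_num)
  obtain ⟨ρ₄, hρ₄⟩ := exists_rep_of_addEquiv W e
  set M : Matrix (Fin 2) (Fin 2) (ZMod (2 ^ 2)) := (ρ₄ σ : Matrix (Fin 2) (Fin 2) (ZMod (2 ^ 2))) with hMdef
  have hM : ∀ P : geomTorsion W ((2 ^ 2 : ℕ) : ℤ), e (σ • P) = M *ᵥ e P := fun P ↦ hρ₄ σ P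
  -- points of `E[2^2]` as points of `E[4]`
  have hmem4 : ∀ P : geomTorsion W ((2 ^ 2 : ℕ) : ℤ), (P : geomPoints W) ∈ geomTorsion W (4 : ℤ) := fun P ↦ by
    rw [← h4]; exact P.2
  have hσP : ∀ P : geomTorsion W ((2 ^ 2 : ℕ) : ℤ), ((σ • P : geomTorsion W ((2 ^ 2 : ℕ) : ℤ)) : geomPoints W) =
      (P : geomPoints W) + (A ⟨(2 : ℤ) • (P : geomPoints W), two_zsmul_mem_geomTorsion_two W ⟨P, hmem4 P⟩⟩ : geomPoints W) := by
    intro P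
    have h := hA ⟨P, hmem4 P⟩
    rw [AddSubgroup.torsionBy.coe_smul] at h ⊢
    exact h
  -- (s1) `σ` fixes `E[2]`, so `M` fixes the `2`-torsion vectors
  have hfix2 : ∀ w : Fin 2 → ZMod (2 ^ 2), w + w = 0 → M *ᵥ w = w := by
    intro w hw
    set T := e.symm w with hT
    have hTT : T + T = 0 := by
      apply e.injective
      rw [map_add, map_zero, hT, e.apply_symm_apply, hw]
    have h2T : (2 : ℤ) • (T : geomPoints W) = 0 := by
      rw [two_zsmul, ← AddSubgroup.coe_add, hTT]; rfl
    -- the datum at `T`: `σ T = T + A(2T) = T + A 0 = T`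
    have hσT : σ • T = T := by
      apply Subtype.ext
      rw [hσP T]
      have h0 : (⟨(2 : ℤ) • (T : geomPoints W), two_zsmul_mem_geomTorsion_two W ⟨T, hmem4 T⟩⟩ : geomTorsion W (2 : ℤ)) = 0 :=
        Subtype.ext h2T
      rw [h0, map_zero, AddSubgroup.coe_zero, add_zero]
    rw [← e.apply_symm_apply w, ← hT, ← hM, hσT]
  -- (s2) `A ∘ A = 0`: `σ` fixes every `R` with `2R = σP − P`
  have hhalf : ∀ u r : Fin 2 → ZMod (2 ^ 2), r + r = M *ᵥ u - u → M *ᵥ r = r := by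
    intro u r hr
    set P := e.symm u with hP
    set R := e.symm r with hR
    have hu : e P = u := by rw [hP, e.apply_symm_apply]
    have hr' : e R = r := by rw [hR, e.apply_symm_apply]
    -- `R + R = σ P - P`
    have hRR : R + R = σ • P - P := by
      apply e.injective
      rw [map_add, map_sub, hM, hu, hr', hr]
    have h2R : (2 : ℤ) • (R : geomPoints W) =
        (A ⟨(2 : ℤ) • (P : geomPoints W), two_zsmul_mem_geomTorsion_two W ⟨P, hmem4 P⟩⟩ : geomPoints W) := by
      rw [two_zsmul, ← AddSubgroup.coe_add, hRR, AddSubgroup.coe_sub, hσP P, add_sub_cancel_left]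
    have hkey : (⟨(2 : ℤ) • (R : geomPoints W), two_zsmul_mem_geomTorsion_two W ⟨R, hmem4 R⟩⟩ : geomTorsion W (2 : ℤ)) =
        A ⟨(2 : ℤ) • (P : geomPoints W), two_zsmul_mem_geomTorsion_two W ⟨P, hmem4 P⟩⟩ := Subtype.ext h2R
    have hσR : σ • R = R := by
      apply Subtype.ext
      rw [hσP R, hkey, ← AddMonoidHom.comp_apply, hAA, AddMonoidHom.zero_apply, AddSubgroup.coe_zero, add_zero]
    rw [← hr', ← hM, hσR]
  -- (s3) the finite lemma: `det M = 1`
  have hdet1 : M.det = 1 := by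
    have hη := Matrix.eta_fin_two M
    rw [Matrix.det_fin_two]
    have h1 := hfix2 ![2, 0] (by decide)
    have h2 := hfix2 ![0, 2] (by decide)
    rw [hη] at h1 h2
    have h3 := hhalf ![1, 0] ![(((M 0 0 - 1).val / 2 : ℕ) : ZMod (2 ^ 2)), (((M 1 0).val / 2 : ℕ) : ZMod (2 ^ 2))]
      (by conv_rhs => rw [hη]
          exact half_fst_add_self (M 0 0) (M 0 1) (M 1 0) (M 1 1) h1 h2)
    have h4 := hhalf ![0, 1] ![(((M 0 1).val / 2 : ℕ) : ZMod (2 ^ 2)), (((M 1 1 - 1).val / 2 : ℕ) : ZMod (2 ^ 2))]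
      (by conv_rhs => rw [hη]
          exact half_snd_add_self (M 0 0) (M 0 1) (M 1 0) (M 1 1) h1 h2)
    have h3' : !![M 0 0, M 0 1; M 1 0, M 1 1] *ᵥ
        ![(((M 0 0 - 1).val / 2 : ℕ) : ZMod (2 ^ 2)), (((M 1 0).val / 2 : ℕ) : ZMod (2 ^ 2))] =
        ![(((M 0 0 - 1).val / 2 : ℕ) : ZMod (2 ^ 2)), (((M 1 0).val / 2 : ℕ) : ZMod (2 ^ 2))] := by
      rw [← hη]; exact h3
    have h4' : !![M 0 0, M 0 1; M 1 0, M 1 1] *ᵥ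
        ![(((M 0 1).val / 2 : ℕ) : ZMod (2 ^ 2)), (((M 1 1 - 1).val / 2 : ℕ) : ZMod (2 ^ 2))] =
        ![(((M 0 1).val / 2 : ℕ) : ZMod (2 ^ 2)), (((M 1 1 - 1).val / 2 : ℕ) : ZMod (2 ^ 2))] := by
      rw [← hη]; exact h4
    exact sub_eq_one_of_frame_conditions (M 0 0) (M 0 1) (M 1 0) (M 1 1) h1 h2 h3' h4'
  -- (s4) `det M = χ₄(σ) = -1`
  have hdetχ : M.det = ((modNCyclotomicCharacter ℚ (2 ^ 2) σ : (ZMod (2 ^ 2))ˣ) : ZMod (2 ^ 2)) :=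
    det_eq_modNCyclotomicCharacter W (2 ^ 2) (by norm_num) e σ M hM
  have hmod : ((modNCyclotomicCharacter ℚ (2 ^ 2) σ : (ZMod (2 ^ 2))ˣ) : ZMod (2 ^ 2)) =
      (GaloisRep.cyclotomicCharacter ℚ 2 σ).val.toZModPow 2 :=
    CyclotomicZp.modNCyclotomicCharacter_eq_toZModPow 2 2 σ
  rw [hdetχ, hmod, hχ] at hdet1
  -- `(-1 : ℤ_[2]) mod 4 ≠ 1`
  have hval : ((-1 : ℤ_[2]ˣ).val.toZModPow 2 : ZMod (2 ^ 2)) = -1 := by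
    rw [Units.val_neg, Units.val_one, map_neg, map_one]
  rw [hval] at hdet1
  exact absurd hdet1 (by decide)

end Datum

/-! ## §3 ★★★ The ordinary witness at a place with unramified `E[2]` -/

section Unramified

variable (W : WeierstrassCurve ℚ) [W.IsElliptic]

/-- ★★★ **THE ORDINARY WITNESS, DISCHARGED.**  `W/ℚ` elliptic with `ρ̄_{W,2}` and `ρ_{W,4}` onto; `v ∋ 2` a place of good ORDINARY
reduction at which `E[2]` is UNRAMIFIED (every element of the inertia group `I_{ℚ_v}` fixes `E[2]`; for ordinary `E/ℚ₂` this is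
`Δ_min ≡ 1 (mod 4)`); `x ≠ 0` the class of `H¹(ℚ, E[2])` dying on `Γ_{ℚ(E[4])}`.  Then **`x ∉ selmerLocalKer W ℚ_v 2`** — the
Lawson–Wuthrich class is not a Kummer class at `v`.  Proof: `χ₂(I_{ℚ_v}) = ℤ₂ˣ` gives an inertial `τ` with `χ(τ) = −1`
(`adicCompletion_rat_exists_mem_absInertia_cyclotomicCharacter_eq`, `cyclotomicCharacter_absGaloisRestrict`); `res τ` fixes `E[2]`, so it has
a datum `A`; §2 gives `A ∘ A ≠ 0`; conclude by `not_mem_selmerLocalKer_two_of_inertia_datum_comp_ne_zero`.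
[cite: SerreLocalFields1979, Ch. IV §4 Prop. 17] [cite: SerreInventiones1972, §1.11 Prop. 11 and Cor.] [cite: LawsonWuthrich2016, §3, §7.1] -/
theorem not_mem_selmerLocalKer_two_of_unramified_twoTorsion
    (hsurj : W.HasSurjectiveModNGaloisRep 2) (hsurj4 : W.HasSurjectiveModNGaloisRep 4)
    (v : HeightOneSpectrum (𝓞 ℚ)) (hv2 : ((2 : ℕ) : 𝓞 ℚ) ∈ v.asIdeal) (hgood : W.HasGoodReductionAt v)
    (hord : ¬ (((2 : ℕ) : ℤ) ∣ W.frobeniusTraceAt v))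
    (hunr : ∀ τ ∈ absInertia (v.adicCompletion ℚ), absGaloisRestrict ℚ (v.adicCompletion ℚ) τ ∈ torsionFixing W (2 : ℤ))
    {x : galH1Torsion W (2 : ℤ)} (hx0 : x ≠ 0) (hx : ∀ h ∈ torsionFixing W (4 : ℤ), h1Eval W (2 : ℤ) x h = 0) :
    x ∉ selmerLocalKer W (v.adicCompletion ℚ) (2 : ℤ) := by
  haveI : Fact (Nat.Prime 2) := ⟨Nat.prime_two⟩
  haveI : NeZero ((2 : ℕ) : ℚ) := ⟨by norm_num⟩
  -- `v` is the place over `2`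
  have hveq : v = Rat.HeightOneSpectrum.primesEquiv.symm ⟨2, Nat.prime_two⟩ := (natCast_prime_mem_iff_eq Nat.prime_two v).mp hv2
  have hv : ((Rat.HeightOneSpectrum.primesEquiv v : Nat.Primes) : ℕ) = 2 := by rw [hveq, Equiv.apply_symm_apply]
  -- an inertial `τ` with `χ(τ) = -1`
  obtain ⟨τ, hτ, hχτ⟩ := adicCompletion_rat_exists_mem_absInertia_cyclotomicCharacter_eq 2 v hv (-1)
  have hχ : GaloisRep.cyclotomicCharacter ℚ 2 (absGaloisRestrict ℚ (v.adicCompletion ℚ) τ) = -1 := by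
    rw [cyclotomicCharacter_absGaloisRestrict ℚ (v.adicCompletion ℚ) 2 τ, hχτ]
  -- its datum
  obtain ⟨A, hA⟩ := exists_smul_eq_add_of_mem_torsionFixing_two W (hunr τ hτ)
  exact not_mem_selmerLocalKer_two_of_inertia_datum_comp_ne_zero W hsurj hsurj4 v hv2 hgood hord hx0 hx hτ hA
    (datum_comp_ne_zero_of_cyclotomicCharacter W hA hχ)

/-- ★★★′ **`(NPh_K)` in F4″'s shape on the unramified-`E[2]` good-ordinary cells.**  `W/ℚ` with `ρ_{W,2^n}` onto for all `n ≥ 1`,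
`v ∋ 2` good ORDINARY with `E[2]` unramified at `v`; `K` imaginary quadratic, `d_K` odd, the two B₂ non-squares, `2` split in `K`.  Then
every class of `H¹(K, E[2^L])` (`L ≥ 1`) dying on `Γ_{K(E[2^L])}` and Kummer at the places over `2` is zero.
[cite: LawsonWuthrich2016, §3, §7.1 and §8] [cite: SerreInventiones1972, §1.11] -/
theorem offCutNonPhantomAtTwo_of_unramified_twoTorsion
    (hρ : ∀ n : ℕ, 0 < n → W.HasSurjectiveModNGaloisRep ((2 : ℤ) ^ n))
    (v : HeightOneSpectrum (𝓞 ℚ)) (hv2 : ((2 : ℕ) : 𝓞 ℚ) ∈ v.asIdeal) (hgood : W.HasGoodReductionAt v)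
    (hord : ¬ (((2 : ℕ) : ℤ) ∣ W.frobeniusTraceAt v))
    (hunr : ∀ τ ∈ absInertia (v.adicCompletion ℚ), absGaloisRestrict ℚ (v.adicCompletion ℚ) τ ∈ torsionFixing W (2 : ℤ))
    {K : Type} [Field K] [NumberField K] (hK : IsImaginaryQuadratic K) (hodd : Odd (NumberField.discr K))
    (hnsq₁ : ¬ IsSquare ((NumberField.discr K : ℚ) * -|W.Δ|))
    (hnsq₂ : ¬ IsSquare ((NumberField.discr K : ℚ) * (-(2 * |W.Δ|))))
    (h2K : ((Ideal.span {(2 : ℤ)}).primesOver (𝓞 K)).ncard = 2) :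
    ∀ (L : ℕ), 1 ≤ L → ∀ z : galH1Torsion (W.baseChange K) ((2 ^ L : ℕ) : ℤ),
      (∀ ρ' ∈ torsionFixing (W.baseChange K) ((2 ^ L : ℕ) : ℤ), h1Eval (W.baseChange K) ((2 ^ L : ℕ) : ℤ) z ρ' = 0) →
      (∀ w : HeightOneSpectrum (𝓞 K), ((2 : ℕ) : 𝓞 K) ∈ w.asIdeal →
        z ∈ selmerLocalKer (W.baseChange K) (w.adicCompletion K) ((2 ^ L : ℕ) : ℤ)) → z = 0 := by
  have hs2 : W.HasSurjectiveModNGaloisRep 2 := by simpa using hρ 1 one_pos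
  have hs4 : W.HasSurjectiveModNGaloisRep 4 := by
    have h := hρ 2 two_pos
    norm_num at h
    exact h
  exact offCutNonPhantomAtTwo_of_levelTwoWitness_two W hρ hK hodd hnsq₁ hnsq₂ h2K
    ⟨v, hv2, fun z hz0 hz ↦ not_mem_selmerLocalKer_two_of_unramified_twoTorsion W hs2 hs4 v hv2 hgood hord hunr hz0 hz⟩

end Unramified

end Summit.BirchSwinnertonDyer.BirchSwinnertonDyer.Theorems.GenusExact.Lw2PhantomExclusion.OrdinaryWitness

end
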